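import Summits.Ventures.PercRepro0.HighDClose
import Summits.Ventures.PercRepro0.PcChi

/-!
# Block H with H1 taken at the print's point of evaluation (seat p3)

`HighDClose.THD_of_H1_P3` consumes H1 at the route's `p_c = inf{θ > 0}`; the print (FvdH 2017,
Corollary 1.3 with (1.4)) states it at `p_c^χ = sup{χ < ∞}`.  `PcChi.H1_Triangle11_of_chi` bridges
the two given P5 · SHARPNESS (S1′) in every dimension `d ≥ 11`.  Composed:

`THD_of_H1chi_P3_P5 : H1_TriangleChi11 → (∀ d ≥ 11, P5_Sharpness d) → (∀ d, P3_Unique d) → THD`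

— Theorem B of the partial proof with exactly the honest hypotheses: the print verbatim (H1 at
`p_c^χ`), sharpness (paper-proved, SHARP-p4-v2), and Burton–Keane uniqueness (paper-proved,
UNIQUENESS-p6-v1); P7, F1, F2 and S5 are kernel-checked.
-/

namespace Summit.Ventures.PercRepro0.HighD

open Defs

/-- T_HD from H1 at the print's `p_c^χ`, sharpness for `d ≥ 11`, and P3. -/
theorem THD_of_H1chi_P3_P5 (hH1 : PcChi.H1_TriangleChi11)
    (hP5 : ∀ d : ℕ, 11 ≤ d → P5_Sharpness d) (hP3 : ∀ d, P3_Unique d) : THD :=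
  THD_of_H1_P3 (PcChi.H1_Triangle11_of_chi hH1 hP5) hP3

/-- The same with sharpness assumed in every dimension (the certificate's form). -/
theorem THD_of_H1chi_P3_P5' (hH1 : PcChi.H1_TriangleChi11) (hP5 : ∀ d : ℕ, P5_Sharpness d)
    (hP3 : ∀ d, P3_Unique d) : THD :=
  THD_of_H1chi_P3_P5 hH1 (fun d _ => hP5 d) hP3

end Summit.Ventures.PercRepro0.HighD
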